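import Literature.NumberTheory.Automorphic.LocalFieldHaarBalls
import Mathlib.Analysis.SpecialFunctions.Pow.Continuity
import HarnessLib

/-!
# `∫_{𝔭ⁿ} |x|^{−s} dx < ∞` for `s < 1` on a non-archimedean local field (the integrable singularity of Tate's local zeta integral at `x = 0`)

Topic `NumberTheory/Automorphic`; theorems only (no definition, no named fact, no instance), in the sub-namespace
`Literature.NumberTheory.Automorphic.LocalFieldHaar`, on top of ★ `LocalFieldHaarBalls` (shell decomposition `integrableOn_and_hasSum_shell`, `μ{0} = 0`).
Cell `pub/hodgecm-mathlib`, crux H413 = `stmt-HodgeConjecture-24833` (lane `--supports`); ROAD «HC-D» (holder F0P2-p01 (g23), LEAD T14-10), brick (D3a)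
«`|x|^{−s}` IS INTEGRABLE NEAR `0`» dealt to F0P2-p02 (g21) 2026-09-02T16:05Z: the model singularity of every shell estimate on the road (`|D(γ)|^{−1∕2}` near a singular
element, the cusp term).  CENSUS RESULT: a COROLLARY of ★ `integrableOn_and_hasSum_shell` — on the shell `𝔭^{n+i} ∖ 𝔭^{n+i+1}` one has `|x| = q^{−(n+i)}`, so
`|x|^{−s} = q^{ns} · (q^s)^i` and `q^s < q ⇔ s < 1` (Tate 1950 §2.4: «`ζ(f, |·|^s)` converges for `Re s > 0`» is the same geometric series with `s ↦ 1 − s`).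

* §1 `normAbs_rpow_neg_eq_of_mem_shell` — the shell value `|x|^{−s} = q^{ns}·(q^s)^i` (measurability is a private helper).
* §2 **`integrableOn_and_hasSum_normAbs_rpow_neg`** (`ℂ`-valued, `𝔭ⁿ ∖ {0}`, with the shell `HasSum`), **`integrableOn_normAbs_rpow_neg`** (`ℝ`-valued, on `𝔭ⁿ`;
  `μ{0} = 0`), **`lintegral_ofReal_normAbs_rpow_neg_lt_top`** (`∫⁻_{𝔭ⁿ} ofReal(|x|^{−s}) < ∞`), **`lintegral_coe_normAbs_rpow_neg_lt_top`** (the `ℝ≥0∞`-rpow form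
  `∫⁻_{𝔭ⁿ} (↑|x|)^{−s} < ∞`, whose integrand is `⊤` at the null point `0`), and the `𝒪 = 𝔭⁰` readings `…_integer`.

HONEST LABEL: count-neutral local harmonic analysis; HC_CM is proved only modulo the printed citations (2 remaining named inputs hLiu418 = `stmt-HodgeConjecture-24832`,
h413 = `stmt-HodgeConjecture-24833`) until rung 0 closes.

## References
* [Tate1950] J. Tate, *Fourier analysis in number fields and Hecke's zeta-functions* (1950), §2.4 (convergence of the local zeta integral for exponent `> 0`), §2.5.
* [WeilBNT1967] A. Weil, *Basic Number Theory* (1967), Ch. I §2, §4 (module, `μ(𝔭^m) = q^{−m}μ(𝒪)`).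
* [BushnellHenniart2006] C. J. Bushnell, G. Henniart, *The local Langlands conjecture for GL(2)* (2006), §23.1 (the zeta integral `∫ Φ(x)|x|^s d^×x`).
-/

set_option autoImplicit false

noncomputable section

open MeasureTheory ValuativeRel Filter Topology Set
open scoped NNReal ENNReal
open Literature.NumberTheory.GaloisRepresentations.IsNonarchimedeanLocalField

namespace Literature.NumberTheory.Automorphic

namespace LocalFieldHaar

variable {F : Type*} [Field F] [ValuativeRel F] [TopologicalSpace F] [IsNonarchimedeanLocalField F]

/-! ### §1 The shell value of `|x|^{−s}` -/

/-- **On the shell `𝔭^{n+i} ∖ 𝔭^{n+i+1}`: `|x|^{−s} = q^{ns} · (q^s)^i`** (`|x| = q^{−(n+i)}`, real powers of the real number `q > 1`). [cite: Tate1950, §2.4] -/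
theorem normAbs_rpow_neg_eq_of_mem_shell (s : ℝ) (n : ℤ) (i : ℕ) {x : F}
    (hx : x ∈ primePowBall F (n + i) \ primePowBall F (n + i + 1)) :
    ((normAbs F x : ℝ)) ^ (-s) = (residueFieldCard F : ℝ) ^ ((n : ℝ) * s) * ((residueFieldCard F : ℝ) ^ s) ^ i := by
  have hq0 : (0 : ℝ) < residueFieldCard F := by exact_mod_cast (one_lt_residueFieldCard F).le.trans_lt' zero_lt_one
  rw [mem_shell_iff] at hx
  rw [hx, NNReal.coe_zpow, NNReal.coe_inv, NNReal.coe_natCast, inv_zpow', ← Real.rpow_intCast,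
    ← Real.rpow_mul hq0.le, ← Real.rpow_natCast, ← Real.rpow_mul hq0.le, ← Real.rpow_add hq0]
  congr 1
  push_cast
  ring

/-- `x ↦ |x|^{−s}` is measurable (continuity of `|·|_F`, ★ `continuous_normAbs`). [folklore] -/
private theorem measurable_normAbs_rpow_neg [MeasurableSpace F] [BorelSpace F] (s : ℝ) :
    Measurable fun x : F => ((normAbs F x : ℝ)) ^ (-s) :=
  (continuous_normAbs (F := F)).measurable.coe_nnreal_real.pow_const _

/-! ### §2 Integrability on `𝔭ⁿ` for `s < 1` -/

variable [MeasurableSpace F] [BorelSpace F] (μ : Measure F) [μ.IsAddHaarMeasure]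

/-- **`x ↦ |x|^{−s}` (as a complex function) is integrable on `𝔭ⁿ ∖ {0}` for every real `s < 1` (no lower bound: for `s ≤ 0` the integrand is bounded), and its integral is the sum of the shell integrals** — ★
`integrableOn_and_hasSum_shell` with `C = q^{ns}`, `θ = q^s < q`. [cite: Tate1950, §2.4] [cite: BushnellHenniart2006, §23.1] -/
theorem integrableOn_and_hasSum_normAbs_rpow_neg {s : ℝ} (hs : s < 1) (n : ℤ) :
    IntegrableOn (fun x : F => ((((normAbs F x : ℝ)) ^ (-s) : ℝ) : ℂ)) (primePowBall F n \ {0}) μ ∧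
    HasSum (fun i : ℕ => ∫ x in primePowBall F (n + i) \ primePowBall F (n + i + 1), ((((normAbs F x : ℝ)) ^ (-s) : ℝ) : ℂ) ∂μ)
      (∫ x in primePowBall F n \ {0}, ((((normAbs F x : ℝ)) ^ (-s) : ℝ) : ℂ) ∂μ) := by
  have hq1 : (1 : ℝ) < residueFieldCard F := by exact_mod_cast one_lt_residueFieldCard F
  have hq0 : (0 : ℝ) < residueFieldCard F := zero_lt_one.trans hq1
  refine integrableOn_and_hasSum_shell μ _ ?_ n (C := (residueFieldCard F : ℝ) ^ ((n : ℝ) * s)) (θ := (residueFieldCard F : ℝ) ^ s)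
    (Real.rpow_nonneg hq0.le _) (Real.rpow_nonneg hq0.le _) ?_ fun i x hx => ?_
  · exact (Complex.measurable_ofReal.comp (measurable_normAbs_rpow_neg s)).aestronglyMeasurable
  · calc (residueFieldCard F : ℝ) ^ s < (residueFieldCard F : ℝ) ^ (1 : ℝ) := Real.rpow_lt_rpow_of_exponent_lt hq1 hs
      _ = residueFieldCard F := Real.rpow_one _
  · rw [Complex.norm_real, Real.norm_of_nonneg (Real.rpow_nonneg (NNReal.coe_nonneg _) _), normAbs_rpow_neg_eq_of_mem_shell s n i hx]

/-- **`x ↦ |x|^{−s}` is integrable on `𝔭ⁿ` for `s < 1`** (real-valued; `{0}` is `μ`-null, ★ `measure_singleton_zero`). [cite: Tate1950, §2.4] [cite: WeilBNT1967, Ch. I §4] -/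
theorem integrableOn_normAbs_rpow_neg {s : ℝ} (hs : s < 1) (n : ℤ) :
    IntegrableOn (fun x : F => ((normAbs F x : ℝ)) ^ (-s)) (primePowBall F n) μ := by
  have h := (integrableOn_and_hasSum_normAbs_rpow_neg μ hs n).1
  have hae : (primePowBall F n \ {0} : Set F) =ᵐ[μ] primePowBall F n :=
    sdiff_ae_eq_self.2 (measure_mono_null inter_subset_right (measure_singleton_zero μ))
  have h' : IntegrableOn (fun x : F => ((((normAbs F x : ℝ)) ^ (-s) : ℝ) : ℂ)) (primePowBall F n) μ := h.congr_set_ae hae.symm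
  have h'' : IntegrableOn (fun x : F => (((((normAbs F x : ℝ)) ^ (-s) : ℝ) : ℂ)).re) (primePowBall F n) μ := h'.re
  simpa only [Complex.ofReal_re] using h''

/-- **`∫⁻_{𝔭ⁿ} |x|^{−s} dμ < ∞` for `s < 1`**, `ENNReal.ofReal` form. [cite: Tate1950, §2.4] [cite: WeilBNT1967, Ch. I §4] -/
theorem lintegral_ofReal_normAbs_rpow_neg_lt_top {s : ℝ} (hs : s < 1) (n : ℤ) :
    ∫⁻ x in primePowBall F n, ENNReal.ofReal (((normAbs F x : ℝ)) ^ (-s)) ∂μ < ∞ :=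
  (integrableOn_normAbs_rpow_neg μ hs n).lintegral_lt_top

/-- **`∫⁻_{𝔭ⁿ} (↑|x|)^{−s} dμ < ∞` for `s < 1`**, the `ℝ≥0∞`-rpow form (the integrand is `⊤` at `x = 0` when `s > 0`, a `μ`-null point; off `0` it is
`ofReal(|x|^{−s})`). [cite: Tate1950, §2.4] [cite: WeilBNT1967, Ch. I §4] -/
theorem lintegral_coe_normAbs_rpow_neg_lt_top {s : ℝ} (hs : s < 1) (n : ℤ) :
    ∫⁻ x in primePowBall F n, ((normAbs F x : ℝ≥0∞)) ^ (-s) ∂μ < ∞ := by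
  have hae : ∀ᵐ x ∂(μ.restrict (primePowBall F n)), ((normAbs F x : ℝ≥0∞)) ^ (-s) = ENNReal.ofReal (((normAbs F x : ℝ)) ^ (-s)) := by
    have h0 : ∀ᵐ x ∂μ, x ≠ (0 : F) := by
      rw [ae_iff]
      simpa only [ne_eq, not_not, setOf_eq_eq_singleton] using measure_singleton_zero μ
    filter_upwards [ae_restrict_of_ae (s := primePowBall F n) h0] with x hx
    have hx' : (normAbs F x) ≠ 0 := (map_ne_zero (normAbs F)).2 hx
    rw [← ENNReal.coe_rpow_of_ne_zero hx', ENNReal.ofReal, ← NNReal.coe_rpow, Real.toNNReal_coe]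
  rw [lintegral_congr_ae hae]
  exact lintegral_ofReal_normAbs_rpow_neg_lt_top μ hs n

/-! ### The readings on `𝒪 = 𝔭⁰` -/

omit [MeasurableSpace F] [BorelSpace F] in
/-- `𝔭⁰ = 𝒪` as sets (★ `mem_primePowBall_zero_iff`). [cite: BushnellHenniart2006, §1.1] -/
theorem primePowBall_zero_eq_integer : primePowBall F 0 = (𝒪[F] : Set F) :=
  Set.ext fun _ => mem_primePowBall_zero_iff

/-- **`x ↦ |x|^{−s}` is integrable on `𝒪` for `s < 1`.** [cite: Tate1950, §2.4] [cite: BushnellHenniart2006, §23.1] -/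
theorem integrableOn_normAbs_rpow_neg_integer {s : ℝ} (hs : s < 1) :
    IntegrableOn (fun x : F => ((normAbs F x : ℝ)) ^ (-s)) (𝒪[F] : Set F) μ := by
  rw [← primePowBall_zero_eq_integer]; exact integrableOn_normAbs_rpow_neg μ hs 0

/-- **`∫⁻_{𝒪} (↑|x|)^{−s} dμ < ∞` for `s < 1`.** [cite: Tate1950, §2.4] [cite: BushnellHenniart2006, §23.1] -/
theorem lintegral_coe_normAbs_rpow_neg_integer_lt_top {s : ℝ} (hs : s < 1) :
    ∫⁻ x in (𝒪[F] : Set F), ((normAbs F x : ℝ≥0∞)) ^ (-s) ∂μ < ∞ := by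
  rw [← primePowBall_zero_eq_integer]; exact lintegral_coe_normAbs_rpow_neg_lt_top μ hs 0

end LocalFieldHaar

end Literature.NumberTheory.Automorphic

end
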